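import Literature.NumberTheory.Transcendental.KZCubicalCalculus

/-!
# `ReductionRigidity` (stmt-KontsevichZagierPeriods-3407), line `Sketch`, stub
# `stub_dilogSectorPresentation`: presentation of the rational dilogarithm sector

Route `KontsevichZagierPeriods/HermiteRigidity`, crux `ReductionRigidity` (stmt-3407), growth line
`bloch-suslin-rational-dilog`, registered sub-goal stub `stub_dilogSectorPresentation` (W6).

Inside the Kontsevich–Zagier formal group `KZ.FormalRep` (the free abelian group on integral
representations) consider the subgroup generated by

* the rational dilogarithm symbols `Dgens = {[□², z/(1 − z x y)] | z ∈ ℚ, z < 1, z ≠ 0}`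
  (value `Li₂(z)`), and
* the weight-`≤ 1` carriers: `W₁gens = {[□², e/((α + β x)(γ + δ y))]}` (products of two logarithmic
  slabs) and `W₂gens = {[□², e/(1 + x y)]}` (the `ζ(2)`-line).

Every element `c` of `closure (Dgens ∪ (W₁gens ∪ W₂gens))` is a `ℤ`-combination of finitely many
symbol representations, indexed by `Fin k`, plus an element of `closure (W₁gens ∪ W₂gens)`:
`c = ∑ᵢ nᵢ • [ρᵢ] + w`. This is pure additive bookkeeping (`AddSubgroup.closure_induction`): the
abstract statement is `closure_union_presentation` below, for an arbitrary additive commutative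
group, an arbitrary family of "symbol" generators `D` described by a predicate, and an arbitrary set
of "carrier" generators `W`; the stub is its specialisation.

References: M. Kontsevich, D. Zagier, *Periods* (2001), §1.2 [cite: KontsevichZagier2001, §1.2].
No definitions are introduced.
-/

noncomputable section

open MeasureTheory Set

namespace Summit.KontsevichZagierPeriods.HermiteRigidity.ReductionRigidity

open Literature.NumberTheory.Transcendental
open Literature.NumberTheory.Transcendental.KZ

/-- **Abstract presentation lemma.** In an additive commutative group, every element of the subgroup
generated by `D ∪ W`, where every element of `D` is of the form `g b` for some `b` admitting a
witness `a` with `P a b`, is a finite `ℤ`-combination `∑ᵢ nᵢ • g (ρ i)` (with `P (z i) (ρ i)` for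
all `i`) plus an element of the subgroup generated by `W`. [folklore] -/
theorem closure_union_presentation {G : Type*} [AddCommGroup G] {A B : Type*}
    (P : A → B → Prop) (g : B → G) (D W : Set G) (hD : ∀ c ∈ D, ∃ a b, P a b ∧ c = g b) :
    ∀ c ∈ AddSubgroup.closure (D ∪ W),
      ∃ (k : ℕ) (z : Fin k → A) (n : Fin k → ℤ) (ρ : Fin k → B), (∀ i, P (z i) (ρ i)) ∧
        ∃ w ∈ AddSubgroup.closure W, c = (∑ i, n i • g (ρ i)) + w := by
  intro c hc
  induction hc using AddSubgroup.closure_induction with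
  | mem c hc =>
    rcases hc with hcD | hcW
    · obtain ⟨a, b, hab, rfl⟩ := hD c hcD
      exact ⟨1, fun _ => a, fun _ => 1, fun _ => b, fun _ => hab, 0, zero_mem _, by simp⟩
    · exact ⟨0, Fin.elim0, Fin.elim0, Fin.elim0, fun i => i.elim0, c,
        AddSubgroup.subset_closure hcW, by simp⟩
  | zero => exact ⟨0, Fin.elim0, Fin.elim0, Fin.elim0, fun i => i.elim0, 0, zero_mem _, by simp⟩
  | add c₁ c₂ _ _ h₁ h₂ =>
    obtain ⟨k₁, z₁, n₁, ρ₁, hP₁, w₁, hw₁, rfl⟩ := h₁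
    obtain ⟨k₂, z₂, n₂, ρ₂, hP₂, w₂, hw₂, rfl⟩ := h₂
    refine ⟨k₁ + k₂, Fin.append z₁ z₂, Fin.append n₁ n₂, Fin.append ρ₁ ρ₂, ?_, w₁ + w₂,
      add_mem hw₁ hw₂, ?_⟩
    · intro i
      induction i using Fin.addCases with
      | left i => simpa only [Fin.append_left] using hP₁ i
      | right i => simpa only [Fin.append_right] using hP₂ i
    · simp only [Fin.sum_univ_add, Fin.append_left, Fin.append_right]
      abel
  | neg c _ h =>
    obtain ⟨k, z, n, ρ, hP, w, hw, rfl⟩ := h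
    refine ⟨k, z, fun i => -n i, ρ, hP, -w, neg_mem hw, ?_⟩
    simp only [neg_zsmul, Finset.sum_neg_distrib, neg_add]

/-- **W6: presentation of the elements of the rational dilogarithm sector.** Every element of the
subgroup of `KZ.FormalRep` generated by the rational dilogarithm symbols `[□², z/(1 − z x y)]`
(`z ∈ ℚ`, `z < 1`, `z ≠ 0`) and the weight-`≤ 1` carriers `[□², e/((α + β x)(γ + δ y))]`,
`[□², e/(1 + x y)]` is a `ℤ`-combination of finitely many symbol representations plus an element of
the carrier subgroup. [cite: KontsevichZagier2001, §1.2] -/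
theorem stub_dilogSectorPresentation : ∀ c ∈ AddSubgroup.closure
      ({c | ∃ (z : ℚ) (r : IntegralRep 2), z < 1 ∧ z ≠ 0 ∧ r.domain = cube 2 ∧
          EqOn r.integrand (fun p => (z : ℝ) / (1 - (z : ℝ) * p 0 * p 1)) (cube 2) ∧ c = KZ.of r} ∪
        ({c | ∃ (r : IntegralRep 2) (e α β γ δ : ℚ), 0 < α ∧ 0 < α + β ∧ 0 < γ ∧ 0 < γ + δ ∧
            r.domain = cube 2 ∧
            EqOn r.integrand (fun p => (e : ℝ) / (((α : ℝ) + β * p 0) * ((γ : ℝ) + δ * p 1))) (cube 2) ∧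
            c = KZ.of r} ∪
          {c | ∃ (r : IntegralRep 2) (e : ℚ), r.domain = cube 2 ∧
            EqOn r.integrand (fun p => (e : ℝ) / (1 + p 0 * p 1)) (cube 2) ∧ c = KZ.of r})),
    ∃ (k : ℕ) (z : Fin k → ℚ) (n : Fin k → ℤ) (ρ : Fin k → IntegralRep 2),
      (∀ i, z i < 1 ∧ z i ≠ 0 ∧ (ρ i).domain = cube 2 ∧
        EqOn (ρ i).integrand (fun p => (z i : ℝ) / (1 - (z i : ℝ) * p 0 * p 1)) (cube 2)) ∧
      ∃ w ∈ AddSubgroup.closure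
        ({c | ∃ (r : IntegralRep 2) (e α β γ δ : ℚ), 0 < α ∧ 0 < α + β ∧ 0 < γ ∧ 0 < γ + δ ∧
            r.domain = cube 2 ∧
            EqOn r.integrand (fun p => (e : ℝ) / (((α : ℝ) + β * p 0) * ((γ : ℝ) + δ * p 1))) (cube 2) ∧
            c = KZ.of r} ∪
          {c | ∃ (r : IntegralRep 2) (e : ℚ), r.domain = cube 2 ∧
            EqOn r.integrand (fun p => (e : ℝ) / (1 + p 0 * p 1)) (cube 2) ∧ c = KZ.of r}),
        c = (∑ i, n i • KZ.of (ρ i)) + w :=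
  closure_union_presentation
    (fun (z : ℚ) (r : IntegralRep 2) => z < 1 ∧ z ≠ 0 ∧ r.domain = cube 2 ∧
      EqOn r.integrand (fun p => (z : ℝ) / (1 - (z : ℝ) * p 0 * p 1)) (cube 2))
    KZ.of _ _ fun _ ⟨z, r, h₁, h₂, h₃, h₄, h₅⟩ => ⟨z, r, ⟨h₁, h₂, h₃, h₄⟩, h₅⟩

end Summit.KontsevichZagierPeriods.HermiteRigidity.ReductionRigidity

end
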